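import Summits.QuantumFields.BalabanUV.Beta.GAN24.AliasObjects

/-!
# `BalabanUV.Beta.GAN24.AliasReindex` — binder row G-an2-4 / (CONV-C), road P1-fibre, typer row **P1-Y11d** (node N17d of
# `GAN24/Formal/LEAVES.md` v2.2), part 1 of 2: the TWO-LEVEL ALIAS RE-INDEXING (item (i) of the row)

NOT IN PRINT; OUR PROOF ATTEMPT.  HONEST FRAMING (cell contract, verbatim): «discharging `BetaPertH` makes Bałaban's UV stability
UNCONDITIONAL — a real constructive-QFT result; it is NOT the continuum limit and NOT the Clay problem.»  HONEST DEPENDENCY (verbatim):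
«continuum YM on T⁴ ⇐ BetaPertH ∧ nine spine estimates (0/9 proved); BetaPertH ⇐ (D1) ∧ (D4) ∧ CAP+tail; G-an2-4 gates asym, D1 and
NE2/3/4.»  [folklore] finite combinatorics of `(ℤ/N)^D` (Mathlib `ZMod.valMinAbs`) and `2π`-periodicity of the building blocks of typer
row T00 `GAN24/AliasObjects` (p201364) — `kAl gs sAl SAl sbAl SbAl chiAl wAl dAl dbAl LAl sMAl SMAl sbMAl SbMAl readW srcW` BY NAME,
nothing redefined; NO estimate, NO cited fact, NO `def … : Prop` hypothesis, NO wall binder.  NOT summit progress; nothing of (CONV-C)'s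
K-slot is discharged here.

## What is proved (row text of `HOME/GAN24/Formal/LEAVES.md` v2.2, P1-Y11d (i), transcribed — with ONE correction, see «Representative»)
Part B of `SKELETON-P1.md` compares the alias sum of level `j` (box side `N = Lc^{j+1}`) with that of level `j+1` (box side `N′ = Lc^{j+2}`)
LABEL BY LABEL: the physical label of an alias class `m ∈ (ℤ/N)^D` above the coarse momentum `p` is `q = p + 2π·s(m)`, `s(m) ∈ ℤ^D` a
representative of `m`, read at the fine scales `q/N` resp. `q/N′` (the currency of `GAN24/SymbolRate`, `GAN24/ReadingWeightRates`).
* §1 «Representative».  T00's fine momentum `kAl N p m = FibreDFT.kFine p m = (p + 2π·repZ m)/N` uses the NONNEGATIVE representative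
  `repZ m i = val (m i) ∈ [0, N)`.  Matching labels by `repZ` (the row's «`repZ (ι m) = repZ m`») would pair the level-`j` class `val = N − 1`
  (the alias `−1`, weight `O(1)`) with the far level-`(j+1)` class `val = N − 1 < N′/2` — NOT a small difference.  The correct matching is by the
  SYMMETRIC representative `srep m i := (m i).valMinAbs ∈ (−N/2, N/2]` (Mathlib), and this file says so: `lift N′ m := (srep m : (ℤ/N′)^D)`,
  **`srep_lift`**: `srep (lift N′ m) = srep m` (`N ≤ N′`), `lift_injective`, and the momentum dictionary `kAl N p m = kSym N p m + 2π·shiftZ m`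
  (`kAl_eq_kSym_add`, `shiftZ m i ∈ {0, 1}`) with `kSym N p m := (p + 2π·srep m)/N`, `kSym N′ p (lift N′ m) = (p + 2π·srep m)/N′` (`kSym_lift`):
  the SAME `q` at the two scales.  (SKELETON/spec agree: `kmat_closed` is `2π`-periodic in every `K[m]`, so the representative is immaterial
  for the OBJECTS — §4 — and only matters for the MATCHING.)
* §2 NEW LABELS.  `newLabels N N′ ⊆ (ℤ/N′)^D` := classes with a coordinate outside the level-`N` window `(−N/2, N/2]`;
  `mem_newLabels_iff_not_mem_range` (they are exactly the complement of `range (lift N′)`), `exists_coord_of_mem_newLabels`: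
  `N ≤ 2·|srep m′ i|` for some `i`, and in the folded-coordinate currency of `GAN24/AliasWeightsSum.alias_tail_sum_le` /
  `GAN24/AliasTail`: `N ≤ 2·min(val, N′ − val)` (`exists_fold_of_mem_newLabels`) — so the E3/L06 TAIL bounds apply to them.
* §3 THE SPLIT.  `sum_eq_sum_lift_add_sum_newLabels`: `Σ_{m′ : (ℤ/N′)^D} F m′ = Σ_{m : (ℤ/N)^D} F (lift N′ m) + Σ_{m′ ∈ newLabels} F m′`;
  `norm_sum_sub_sum_le`: `‖Σ_{m′} F′ m′ − Σ_m F m‖ ≤ Σ_m ‖F′ (lift m) − F m‖ + Σ_{m′ ∈ newLabels} ‖F′ m′‖`, and the rate form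
  `norm_sum_sub_sum_le_of_rates` (matched rates `ρ m` + a tail bound `τ`).
* §4 `2π`-PERIODICITY DICTIONARY: `gs (z + 2πk) n = gs z n`, `dhat/dflat/lapSym` are `2πℤ^D`-periodic, hence every per-alias object of T00 is
  a function of `kSym`: `sAl_eq_kSym … LAl_eq_kSym`, `readPhase_eq_kSym` (the reading phase `e^{i k_m·Mρ}`), `readW_eq_kSym`, `srcW_eq_kSym`.
No analysis.  Consumers: part 2 `GAN24/ClosedFormRateOfParts` (row Y11d (ii)(iii)), p1 row L11 `FibreRate`, rows Y11r (iii)(iv) / Y11s.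
-/

noncomputable section

open Complex Finset
open scoped BigOperators Real
open Literature.Probability.LatticeModels (TorusSite)
open Literature.MathematicalPhysics.QuantumFieldTheory
open Literature.MathematicalPhysics.QuantumFieldTheory.LatticeForm (repZ)
open Summit.QuantumFields.BalabanUV.Beta.GAN24.FibreSymbols (dhat dflat lapSym)
open Summit.QuantumFields.BalabanUV.Beta.GAN24.AliasObjects
  (kAl kAl_apply gs sAl SAl sbAl SbAl chiAl wAl dAl dbAl LAl sMAl SMAl sbMAl SbMAl readW srcW)

namespace Summit.QuantumFields.BalabanUV.Beta.GAN24.AliasReindex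

variable {D : ℕ}

/-! ## §1 The symmetric representative and the lift `(ℤ/N)^D → (ℤ/N′)^D` -/

section Lift

variable {N N' : ℕ}

/-- [folklore] The SYMMETRIC representative of an alias class: `srep m i = valMinAbs (m i) ∈ (−N/2, N/2]`. -/
def srep (m : TorusSite D N) : Fin D → ℤ := fun i => (m i).valMinAbs

/-- [folklore] Unfolding. -/
theorem srep_apply (m : TorusSite D N) (i : Fin D) : srep m i = (m i).valMinAbs := rfl
/-- [folklore] The window: `2·srep m i ∈ (−N, N]`. -/
theorem srep_mul_two_mem_Ioc [NeZero N] (m : TorusSite D N) (i : Fin D) :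
    srep m i * 2 ∈ Set.Ioc (-(N : ℤ)) N :=
  (m i).valMinAbs_mem_Ioc

/-- [folklore] `|srep m i| ≤ N/2` (natural-number form). -/
theorem natAbs_srep_le [NeZero N] (m : TorusSite D N) (i : Fin D) : (srep m i).natAbs ≤ N / 2 :=
  (m i).natAbs_valMinAbs_le

/-- [folklore] `|srep m i|` is the FOLDED coordinate `min (val, N − val)` of `GAN24/AliasWeightsSum`. -/
theorem natAbs_srep_eq_min [NeZero N] (m : TorusSite D N) (i : Fin D) :
    (srep m i).natAbs = min (m i).val (N - (m i).val) :=
  (m i).valMinAbs_natAbs_eq_min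

/-- [folklore] `srep` is injective (a class is determined by its symmetric representative). -/
theorem srep_injective : Function.Injective (srep : TorusSite D N → Fin D → ℤ) := by
  intro m m' h
  funext i
  exact ZMod.valMinAbs_inj.1 (congrFun h i)

/-- [folklore] Casting the symmetric representative back gives the class. -/
theorem intCast_srep (m : TorusSite D N) (i : Fin D) : ((srep m i : ℤ) : ZMod N) = m i :=
  (m i).coe_valMinAbs

/-- [folklore] THE LIFT of a level-`N` alias class to level `N′`: the class of its symmetric representative. -/
def lift (N' : ℕ) (m : TorusSite D N) : TorusSite D N' := fun i => ((srep m i : ℤ) : ZMod N')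

/-- [folklore] Unfolding. -/
theorem lift_apply (N' : ℕ) (m : TorusSite D N) (i : Fin D) : lift N' m i = ((srep m i : ℤ) : ZMod N') := rfl
/-- [folklore] **THE LIFT PRESERVES THE SYMMETRIC REPRESENTATIVE** (`N ≤ N′`): `srep (lift N′ m) = srep m` — the same physical label
`q = p + 2π·srep m` at both levels. -/
theorem srep_lift [NeZero N] [NeZero N'] (hNN' : N ≤ N') (m : TorusSite D N) : srep (lift N' m) = srep m := by
  funext i
  rw [srep_apply, lift_apply, ZMod.valMinAbs_spec]
  refine ⟨rfl, ?_⟩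
  have h := srep_mul_two_mem_Ioc m i
  exact ⟨by linarith [h.1, (Int.ofNat_le.2 hNN' : (N : ℤ) ≤ N')], h.2.trans (Int.ofNat_le.2 hNN')⟩

/-- [folklore] The lift is injective (`N ≤ N′`). -/
theorem lift_injective [NeZero N] [NeZero N'] (hNN' : N ≤ N') : Function.Injective (lift N' : TorusSite D N → TorusSite D N') := by
  intro m m' h
  apply srep_injective
  rw [← srep_lift hNN' m, ← srep_lift hNN' m', h]

/-- [folklore] RANGE CRITERION: a level-`N′` class is a lift iff all its symmetric coordinates lie in the level-`N` window `(−N/2, N/2]`. -/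
theorem mem_range_lift_iff [NeZero N] [NeZero N'] (hNN' : N ≤ N') (m' : TorusSite D N') :
    m' ∈ Set.range (lift N' : TorusSite D N → TorusSite D N') ↔ ∀ i, srep m' i * 2 ∈ Set.Ioc (-(N : ℤ)) N := by
  constructor
  · rintro ⟨m, rfl⟩ i
    rw [srep_lift hNN']
    exact srep_mul_two_mem_Ioc m i
  · intro h
    refine ⟨fun i => ((srep m' i : ℤ) : ZMod N), funext fun i => ?_⟩
    have hs : srep (fun i => ((srep m' i : ℤ) : ZMod N) : TorusSite D N) i = srep m' i := by
      rw [srep_apply, ZMod.valMinAbs_spec]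
      exact ⟨rfl, h i⟩
    rw [lift_apply, hs, srep_apply, ZMod.coe_valMinAbs]

end Lift

/-! ## §2 The new labels of the finer level -/

section New

variable {N N' : ℕ}

/-- [folklore] THE NEW LABELS at level `N′` relative to level `N`: classes with a symmetric coordinate OUTSIDE the window `(−N/2, N/2]`. -/
def newLabels (N N' : ℕ) [NeZero N'] : Finset (TorusSite D N') :=
  Finset.univ.filter fun m' => ∃ i, ¬(-(N : ℤ) < srep m' i * 2 ∧ srep m' i * 2 ≤ (N : ℤ))

/-- [folklore] Membership in `newLabels`. -/
theorem mem_newLabels_iff [NeZero N'] (m' : TorusSite D N') :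
    m' ∈ (newLabels N N' : Finset (TorusSite D N')) ↔ ∃ i, ¬(-(N : ℤ) < srep m' i * 2 ∧ srep m' i * 2 ≤ (N : ℤ)) := by
  simp [newLabels]

/-- [folklore] **THE NEW LABELS ARE EXACTLY THE NON-LIFTS** (`N ≤ N′`). -/
theorem mem_newLabels_iff_not_mem_range [NeZero N] [NeZero N'] (hNN' : N ≤ N') (m' : TorusSite D N') :
    m' ∈ (newLabels N N' : Finset (TorusSite D N')) ↔ m' ∉ Set.range (lift N' : TorusSite D N → TorusSite D N') := by
  rw [mem_newLabels_iff, mem_range_lift_iff hNN', not_forall]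
  simp only [Set.mem_Ioc]

/-- [folklore] A lift is not a new label. -/
theorem lift_not_mem_newLabels [NeZero N] [NeZero N'] (hNN' : N ≤ N') (m : TorusSite D N) :
    lift N' m ∉ (newLabels N N' : Finset (TorusSite D N')) := by
  rw [mem_newLabels_iff_not_mem_range hNN', not_not]
  exact ⟨m, rfl⟩

/-- [folklore] **A NEW LABEL HAS A LARGE COORDINATE**: `N ≤ 2·|srep m′ i|` for some `i`. -/
theorem exists_coord_of_mem_newLabels [NeZero N'] {m' : TorusSite D N'} (h : m' ∈ (newLabels N N' : Finset (TorusSite D N'))) :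
    ∃ i, (N : ℤ) ≤ 2 * |srep m' i| := by
  obtain ⟨i, hi⟩ := (mem_newLabels_iff m').1 h
  refine ⟨i, ?_⟩
  rw [not_and_or, not_lt, not_le] at hi
  rcases hi with hi | hi
  · have : srep m' i * 2 ≤ -(N : ℤ) := hi
    have h2 : (N : ℤ) ≤ 2 * (-srep m' i) := by linarith
    exact h2.trans (by linarith [neg_le_abs (srep m' i)])
  · have h2 : (N : ℤ) ≤ 2 * srep m' i := by linarith
    exact h2.trans (by linarith [le_abs_self (srep m' i)])

/-- [folklore] The same in the FOLDED-COORDINATE currency of `GAN24/AliasWeightsSum` / `GAN24/AliasTail`: `N ≤ 2·min(val, N′ − val)`. -/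
theorem exists_fold_of_mem_newLabels [NeZero N'] {m' : TorusSite D N'} (h : m' ∈ (newLabels N N' : Finset (TorusSite D N'))) :
    ∃ i, N ≤ 2 * min (m' i).val (N' - (m' i).val) := by
  obtain ⟨i, hi⟩ := exists_coord_of_mem_newLabels h
  refine ⟨i, ?_⟩
  rw [← natAbs_srep_eq_min, ← Int.ofNat_le]
  push_cast
  simpa [Int.natCast_natAbs] using hi

end New

/-! ## §3 The two-level split of an alias sum -/

section Split

variable {N N' : ℕ} [NeZero N] [NeZero N']

/-- [folklore] The lifts, as a finite set, are the complement of the new labels. -/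
theorem filter_not_mem_newLabels_eq_image (hNN' : N ≤ N') :
    (Finset.univ.filter fun m' : TorusSite D N' => m' ∉ (newLabels N N' : Finset (TorusSite D N'))) =
      Finset.univ.image (lift N' : TorusSite D N → TorusSite D N') := by
  ext m'
  simp only [Finset.mem_filter, Finset.mem_univ, true_and, Finset.mem_image, mem_newLabels_iff_not_mem_range hNN', not_not,
    Set.mem_range]

/-- [folklore] **THE SPLIT**: `Σ_{m′ : (ℤ/N′)^D} F m′ = Σ_{m : (ℤ/N)^D} F (lift N′ m) + Σ_{m′ ∈ newLabels N N′} F m′` (`N ≤ N′`). -/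
theorem sum_eq_sum_lift_add_sum_newLabels {E : Type*} [AddCommMonoid E] (hNN' : N ≤ N') (F : TorusSite D N' → E) :
    ∑ m', F m' = ∑ m : TorusSite D N, F (lift N' m) + ∑ m' ∈ newLabels N N', F m' := by
  rw [← Finset.sum_filter_add_sum_filter_not Finset.univ (fun m' => m' ∈ (newLabels N N' : Finset (TorusSite D N'))) F,
    add_comm, filter_not_mem_newLabels_eq_image hNN', Finset.sum_image fun m _ m' _ h => lift_injective hNN' h]
  congr 1
  refine Finset.sum_congr ?_ fun _ _ => rfl
  ext m'
  simp

/-- [folklore] **TWO-LEVEL COMPARISON OF ALIAS SUMS**: matched labels termwise + the new labels as a tail,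
`‖Σ_{m′} F′ m′ − Σ_m F m‖ ≤ Σ_m ‖F′ (lift N′ m) − F m‖ + Σ_{m′ ∈ newLabels} ‖F′ m′‖`. -/
theorem norm_sum_sub_sum_le (hNN' : N ≤ N') (F : TorusSite D N → ℂ) (F' : TorusSite D N' → ℂ) :
    ‖∑ m', F' m' - ∑ m, F m‖ ≤ ∑ m : TorusSite D N, ‖F' (lift N' m) - F m‖ + ∑ m' ∈ newLabels N N', ‖F' m'‖ := by
  rw [sum_eq_sum_lift_add_sum_newLabels hNN' F', add_sub_right_comm, ← Finset.sum_sub_distrib]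
  exact (norm_add_le _ _).trans (add_le_add (norm_sum_le _ _) (norm_sum_le _ _))

/-- [folklore] **RATE FORM**: matched-label rates `‖F′ (lift m) − F m‖ ≤ ρ m` and a tail bound `Σ_{new} ‖F′ m′‖ ≤ τ` give
`‖Σ′ − Σ‖ ≤ Σ_m ρ m + τ`. -/
theorem norm_sum_sub_sum_le_of_rates (hNN' : N ≤ N') (F : TorusSite D N → ℂ) (F' : TorusSite D N' → ℂ)
    (ρ : TorusSite D N → ℝ) {τ : ℝ} (hρ : ∀ m, ‖F' (lift N' m) - F m‖ ≤ ρ m) (hτ : ∑ m' ∈ newLabels N N', ‖F' m'‖ ≤ τ) :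
    ‖∑ m', F' m' - ∑ m, F m‖ ≤ ∑ m : TorusSite D N, ρ m + τ :=
  (norm_sum_sub_sum_le hNN' F F').trans (add_le_add (Finset.sum_le_sum fun m _ => hρ m) hτ)

/-- [folklore] The same with outer scalar prefactors (the unit factors of the two levels) pushed inside. -/
theorem norm_mul_sum_sub_mul_sum_le_of_rates (hNN' : N ≤ N') (c c' : ℂ) (F : TorusSite D N → ℂ) (F' : TorusSite D N' → ℂ)
    (ρ : TorusSite D N → ℝ) {τ : ℝ} (hρ : ∀ m, ‖c' * F' (lift N' m) - c * F m‖ ≤ ρ m) (hτ : ∑ m' ∈ newLabels N N', ‖c' * F' m'‖ ≤ τ) :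
    ‖c' * ∑ m', F' m' - c * ∑ m, F m‖ ≤ ∑ m : TorusSite D N, ρ m + τ := by
  rw [Finset.mul_sum, Finset.mul_sum]
  exact norm_sum_sub_sum_le_of_rates hNN' (fun m => c * F m) (fun m' => c' * F' m') ρ hρ hτ

end Split

/-! ## §4 The momentum dictionary and the `2π`-periodicity of T00's per-alias objects -/

section Momentum

/-- [folklore] The SYMMETRISED fine momentum `kSym N p m = (p + 2π·srep m)/N` (the label `q = p + 2π·srep m` at scale `1/N`). -/
def kSym (N : ℕ) (p : Fin D → ℂ) (m : TorusSite D N) : Fin D → ℂ := fun i => (p i + 2 * π * (srep m i : ℂ)) / (N : ℂ)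

/-- [folklore] Unfolding. -/
theorem kSym_apply {N : ℕ} (p : Fin D → ℂ) (m : TorusSite D N) (i : Fin D) :
    kSym N p m i = (p i + 2 * π * (srep m i : ℂ)) / (N : ℂ) := rfl

variable {N N' : ℕ} [NeZero N] [NeZero N']
/-- [folklore] **THE SAME LABEL AT THE FINER SCALE**: `kSym N′ p (lift N′ m) = (p + 2π·srep m)/N′`. -/
theorem kSym_lift (hNN' : N ≤ N') (p : Fin D → ℂ) (m : TorusSite D N) (i : Fin D) :
    kSym N' p (lift N' m) i = (p i + 2 * π * (srep m i : ℂ)) / (N' : ℂ) := by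
  rw [kSym_apply, srep_lift hNN']

/-- [folklore] The winding of the nonnegative representative: `0` on the lower half `val ≤ N/2`, `1` on the upper half. -/
def shiftZ (m : TorusSite D N) (i : Fin D) : ℤ := if (m i).val ≤ N / 2 then 0 else 1

/-- [folklore] `repZ m i = srep m i + N·shiftZ m i`. -/
theorem repZ_eq_srep_add (m : TorusSite D N) (i : Fin D) : repZ m i = srep m i + (N : ℤ) * shiftZ m i := by
  show (((m i).val : ℕ) : ℤ) = (m i).valMinAbs + (N : ℤ) * shiftZ m i
  rw [ZMod.val_eq_ite_valMinAbs, shiftZ]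
  split_ifs <;> simp

/-- [folklore] **MOMENTUM DICTIONARY**: `kAl N p m = kSym N p m + 2π·shiftZ m` — T00's fine momentum and the symmetrised one differ by a
lattice vector of `2πℤ^D`. -/
theorem kAl_eq_kSym_add (p : Fin D → ℂ) (m : TorusSite D N) (i : Fin D) :
    kAl N p m i = kSym N p m i + 2 * π * (shiftZ m i : ℂ) := by
  have hN : (N : ℂ) ≠ 0 := Nat.cast_ne_zero.2 (NeZero.ne N)
  rw [kAl_apply, kSym_apply, repZ_eq_srep_add]
  push_cast
  field_simp
  ring

/-- [folklore] `e^{i(z + 2πk)t} = e^{izt}` for integers `k`, naturals `t`. -/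
theorem cexp_I_mul_add_two_pi_mul (z : ℂ) (k : ℤ) (t : ℕ) : cexp (I * (z + 2 * π * k) * t) = cexp (I * z * t) := by
  have e : I * (z + 2 * π * k) * t = I * z * t + ((k * t : ℤ) : ℂ) * (2 * π * I) := by push_cast; ring
  rw [e, Complex.exp_add, Complex.exp_int_mul_two_pi_mul_I, mul_one]

/-- [folklore] The geometric sum is `2π`-periodic: `gs (z + 2πk) n = gs z n`. -/
theorem gs_add_two_pi_mul (z : ℂ) (k : ℤ) (n : ℕ) : gs (z + 2 * π * k) n = gs z n := by
  unfold gs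
  exact Finset.sum_congr rfl fun t _ => cexp_I_mul_add_two_pi_mul z k t

/-- [folklore] … and so is its reflection: `gs (−(z + 2πk)) n = gs (−z) n`. -/
theorem gs_neg_add_two_pi_mul (z : ℂ) (k : ℤ) (n : ℕ) : gs (-(z + 2 * π * k)) n = gs (-z) n := by
  have e : -(z + 2 * π * (k : ℂ)) = -z + 2 * π * ((-k : ℤ) : ℂ) := by push_cast; ring
  rw [e, gs_add_two_pi_mul]

/-- [folklore] `e^{i(w + 2πk)} = e^{iw}`. -/
theorem cexp_I_mul_add_two_pi_mul' (w : ℂ) (k : ℤ) : cexp (I * (w + 2 * π * k)) = cexp (I * w) := by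
  have e : I * (w + 2 * π * k) = I * w + (k : ℂ) * (2 * π * I) := by ring
  rw [e, Complex.exp_add, Complex.exp_int_mul_two_pi_mul_I, mul_one]

/-- [folklore] `∂̂` is `2πℤ^D`-periodic. -/
theorem dhat_add_two_pi (k : Fin D → ℂ) (z : Fin D → ℤ) (κ : Fin D) :
    dhat (fun i => k i + 2 * π * (z i : ℂ)) κ = dhat k κ := by
  unfold dhat
  rw [cexp_I_mul_add_two_pi_mul']

/-- [folklore] `∂̂♭` is `2πℤ^D`-periodic. -/
theorem dflat_add_two_pi (k : Fin D → ℂ) (z : Fin D → ℤ) (κ : Fin D) :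
    dflat (fun i => k i + 2 * π * (z i : ℂ)) κ = dflat k κ := by
  unfold dflat
  have e : -(I * (k κ + 2 * π * (z κ : ℂ))) = I * (-k κ + 2 * π * ((-z κ : ℤ) : ℂ)) := by push_cast; ring
  have e' : -(I * k κ) = I * (-k κ) := by ring
  rw [e, cexp_I_mul_add_two_pi_mul', e']

/-- [folklore] `L = |∂̂|²` is `2πℤ^D`-periodic. -/
theorem lapSym_add_two_pi (k : Fin D → ℂ) (z : Fin D → ℤ) :
    lapSym (fun i => k i + 2 * π * (z i : ℂ)) = lapSym k := by
  unfold lapSym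
  exact Finset.sum_congr rfl fun κ _ => by rw [dhat_add_two_pi, dflat_add_two_pi]

/-- [folklore] `kAl` as `kSym` shifted by the lattice vector `2π·shiftZ` (function form). -/
theorem kAl_eq_fun (p : Fin D → ℂ) (m : TorusSite D N) : kAl N p m = fun i => kSym N p m i + 2 * π * (shiftZ m i : ℂ) :=
  funext fun i => kAl_eq_kSym_add p m i

/-- [folklore] `s_κ(m) = gs (kSym_κ) N`. -/
theorem sAl_eq_kSym (p : Fin D → ℂ) (m : TorusSite D N) (κ : Fin D) : sAl N p m κ = gs (kSym N p m κ) N := by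
  rw [sAl, kAl_eq_kSym_add, gs_add_two_pi_mul]

/-- [folklore] `s♭_κ(m) = gs (−kSym_κ) N`. -/
theorem sbAl_eq_kSym (p : Fin D → ℂ) (m : TorusSite D N) (κ : Fin D) : sbAl N p m κ = gs (-kSym N p m κ) N := by
  rw [sbAl, kAl_eq_kSym_add, gs_neg_add_two_pi_mul]

/-- [folklore] `S(m) = Π_i gs (kSym_i) N`. -/
theorem SAl_eq_kSym (p : Fin D → ℂ) (m : TorusSite D N) : SAl N p m = ∏ i, gs (kSym N p m i) N :=
  Finset.prod_congr rfl fun i _ => sAl_eq_kSym p m i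
/-- [folklore] `S♭(m) = Π_i gs (−kSym_i) N`. -/
theorem SbAl_eq_kSym (p : Fin D → ℂ) (m : TorusSite D N) : SbAl N p m = ∏ i, gs (-kSym N p m i) N :=
  Finset.prod_congr rfl fun i _ => sbAl_eq_kSym p m i

/-- [folklore] `χ̂(m) = Π_i gs (−kSym_i) N / N^D`. -/
theorem chiAl_eq_kSym (p : Fin D → ℂ) (m : TorusSite D N) : chiAl N p m = (∏ i, gs (-kSym N p m i) N) / (N : ℂ) ^ D := by
  rw [chiAl, SbAl_eq_kSym]

/-- [folklore] `w_m = (Π gs (kSym_i) N)·(Π gs (−kSym_i) N)/N^D`. -/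
theorem wAl_eq_kSym (p : Fin D → ℂ) (m : TorusSite D N) :
    wAl N p m = (∏ i, gs (kSym N p m i) N) * ((∏ i, gs (-kSym N p m i) N) / (N : ℂ) ^ D) := by
  rw [wAl, SAl_eq_kSym, chiAl_eq_kSym]

/-- [folklore] `s_{M,κ}(m) = gs (kSym_κ) M`. -/
theorem sMAl_eq_kSym (M : ℕ) (p : Fin D → ℂ) (m : TorusSite D N) (κ : Fin D) : sMAl N M p m κ = gs (kSym N p m κ) M := by
  rw [sMAl, kAl_eq_kSym_add, gs_add_two_pi_mul]
/-- [folklore] `s♭_{M,κ}(m) = gs (−kSym_κ) M`. -/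
theorem sbMAl_eq_kSym (M : ℕ) (p : Fin D → ℂ) (m : TorusSite D N) (κ : Fin D) : sbMAl N M p m κ = gs (-kSym N p m κ) M := by
  rw [sbMAl, kAl_eq_kSym_add, gs_neg_add_two_pi_mul]

/-- [folklore] `S_M(m) = Π_i gs (kSym_i) M`. -/
theorem SMAl_eq_kSym (M : ℕ) (p : Fin D → ℂ) (m : TorusSite D N) : SMAl N M p m = ∏ i, gs (kSym N p m i) M :=
  Finset.prod_congr rfl fun i _ => sMAl_eq_kSym M p m i
/-- [folklore] `S♭_M(m) = Π_i gs (−kSym_i) M`. -/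
theorem SbMAl_eq_kSym (M : ℕ) (p : Fin D → ℂ) (m : TorusSite D N) : SbMAl N M p m = ∏ i, gs (-kSym N p m i) M :=
  Finset.prod_congr rfl fun i _ => sbMAl_eq_kSym M p m i

/-- [folklore] `∂_m = ∂̂(kSym)`. -/
theorem dAl_eq_kSym (p : Fin D → ℂ) (m : TorusSite D N) : dAl N p m = dhat (kSym N p m) := by
  funext κ
  show dhat (kAl N p m) κ = _
  rw [kAl_eq_fun, dhat_add_two_pi]
/-- [folklore] `∂♭_m = ∂̂♭(kSym)`. -/
theorem dbAl_eq_kSym (p : Fin D → ℂ) (m : TorusSite D N) : dbAl N p m = dflat (kSym N p m) := by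
  funext κ
  show dflat (kAl N p m) κ = _
  rw [kAl_eq_fun, dflat_add_two_pi]

/-- [folklore] `L_m = L(kSym)`. -/
theorem LAl_eq_kSym (p : Fin D → ℂ) (m : TorusSite D N) : LAl N p m = lapSym (kSym N p m) := by
  show lapSym (kAl N p m) = _
  rw [kAl_eq_fun, lapSym_add_two_pi]

/-- [folklore] THE READING PHASE is a function of the label: `e^{i Σ_i kAl_i·(Mρ_i)} = e^{i Σ_i kSym_i·(Mρ_i)}` (`Mρ ∈ ℤ^D`). -/
theorem readPhase_eq_kSym (M : ℕ) (p : Fin D → ℂ) (m : TorusSite D N) (ρ : Fin D → ℤ) :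
    cexp (I * ∑ i, kAl N p m i * ((M : ℂ) * (ρ i : ℂ))) = cexp (I * ∑ i, kSym N p m i * ((M : ℂ) * (ρ i : ℂ))) := by
  have e : I * ∑ i, kAl N p m i * ((M : ℂ) * (ρ i : ℂ)) =
      I * ∑ i, kSym N p m i * ((M : ℂ) * (ρ i : ℂ)) + ((∑ i, shiftZ m i * ((M : ℤ) * ρ i) : ℤ) : ℂ) * (2 * π * I) := by
    rw [Finset.mul_sum, Finset.mul_sum, Int.cast_sum, Finset.sum_mul, ← Finset.sum_add_distrib]
    refine Finset.sum_congr rfl fun i _ => ?_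
    rw [kAl_eq_kSym_add]
    push_cast
    ring
  rw [e, Complex.exp_add, Complex.exp_int_mul_two_pi_mul_I, mul_one]

/-- [folklore] … and so is its reflection (the source phase). -/
theorem srcPhase_eq_kSym (M : ℕ) (p : Fin D → ℂ) (m : TorusSite D N) (ρ : Fin D → ℤ) :
    cexp (-(I * ∑ i, kAl N p m i * ((M : ℂ) * (ρ i : ℂ)))) = cexp (-(I * ∑ i, kSym N p m i * ((M : ℂ) * (ρ i : ℂ)))) := by
  have e : ∀ k : Fin D → ℂ, -(I * ∑ i, k i * ((M : ℂ) * (ρ i : ℂ))) = I * ∑ i, k i * ((M : ℂ) * (((-ρ i : ℤ)) : ℂ)) := by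
    intro k
    rw [← mul_neg, ← Finset.sum_neg_distrib]
    congr 1
    exact Finset.sum_congr rfl fun i _ => by push_cast; ring
  rw [e, e, readPhase_eq_kSym]

/-- [folklore] **THE READING WEIGHT IS A FUNCTION OF THE LABEL**:
`readW N M p m κ ρ = e^{i kSym·Mρ} · (Π_i gs (kSym_i) M) · gs (kSym_κ) M / M^{D+1}`. -/
theorem readW_eq_kSym (M : ℕ) (p : Fin D → ℂ) (m : TorusSite D N) (κ : Fin D) (ρ : Fin D → ℤ) :
    readW N M p m κ ρ = cexp (I * ∑ i, kSym N p m i * ((M : ℂ) * (ρ i : ℂ))) * (∏ i, gs (kSym N p m i) M) *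
      gs (kSym N p m κ) M / (M : ℂ) ^ (D + 1) := by
  rw [readW, readPhase_eq_kSym, SMAl_eq_kSym, sMAl_eq_kSym]

/-- [folklore] **THE SOURCE WEIGHT IS A FUNCTION OF THE LABEL**:
`srcW N M p m κ ρ = e^{−i kSym·Mρ} · (Π_i gs (−kSym_i) M) · gs (−kSym_κ) M / M^{D+1} / N^D`. -/
theorem srcW_eq_kSym (M : ℕ) (p : Fin D → ℂ) (m : TorusSite D N) (κ : Fin D) (ρ : Fin D → ℤ) :
    srcW N M p m κ ρ = cexp (-(I * ∑ i, kSym N p m i * ((M : ℂ) * (ρ i : ℂ)))) * (∏ i, gs (-kSym N p m i) M) *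
      gs (-kSym N p m κ) M / (M : ℂ) ^ (D + 1) / (N : ℂ) ^ D := by
  rw [srcW, srcPhase_eq_kSym, SbMAl_eq_kSym, sbMAl_eq_kSym]

end Momentum

end Summit.QuantumFields.BalabanUV.Beta.GAN24.AliasReindex

end
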